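import Literature.NumberTheory.EllipticCurves.PastenEigenSystemCountProofs
import Literature.NumberTheory.EllipticCurves.PeriodRelationsProofs
import Literature.NumberTheory.EllipticCurves.PastenSpectralDegreeIsogenyBoundProofs
import Literature.NumberTheory.EllipticCurves.ModularParametrizationProofs
import Literature.NumberTheory.EllipticCurves.ModularParametrizationHoldsProofs
import Literature.NumberTheory.EllipticCurves.DeligneHeckeEigenvalueBoundProofs
import HarnessLib

/-!
# Pasten's Theorem 7.5 from its printed external inputs
# (proofs-only sibling of `PastenValuationProduct.lean`; theorems only, D-0026)

Topic `NumberTheory/EllipticCurves`. The named fact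
`Literature.NumberTheory.EllipticCurves.pasten_thm_7_5` (`PastenValuationProduct.lean`; H. Pasten,
*Shimura curves and the abc conjecture*, Thm. 7.5, proof §7.4 p. 27 with §3 p. 13 and Thm. 7.2,
proof p. 26: for every `ε > 0` and every elliptic curve `E/ℚ` of conductor `N ≫_ε 1`,
`log |Δ_E| < (1/4 + ε) N log N`) was reduced by this seat, in the siblings
`PastenValuationProductThm75Proofs`, `PastenValuationProductThm75AsymptoticProofs` and
`PastenEigenSystemCountProofs`, to five hypotheses
(`pasten_thm_7_5_of_modularity_of_murtyLemma`): the Modularity Theorem with integral Manin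
constant (`nonempty_modularParametrizationData`), the Mazur–Kenku comparison
(`PastenShimura2024_minimalDegree_le_163_mul`), Pasten's Thm. 5.5 (`PastenShimura2024_thm_5_5`),
Deligne's bound (`Deligne1974_heckeT_eigenvalue_norm_le`) and Murty's Lemma 11 (`hMurty`, not
vendored); every step that Pasten *proves* (Silverman's `log |Δ| ≤ 12 h + 16`, the Frey–Zagier
degree formula, the trivial Petersson bound, Prop. 7.1, the size of `η` from a distinguishing index,
the bookkeeping of §7.4) being a theorem of the tree.

Since then the tree has moved on three of the five:

* **Thm. 5.5 is a theorem**: `PastenShimura2024_thm_5_5_holds` (`PeriodRelationsProofs`, Riemann's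
  period relations for `X₀(N)` in Petersson form feeding Ribet's `deg ∣ congruence number`);
* **modularity with integral Manin constant is modularity "Version `a_p`"**:
  `nonempty_modularParametrizationData` follows from `exists_isNewformOf` alone
  (`nonempty_modularParametrizationData_of_modularity` with the discharged leaf
  `IsNewformOf.exists_maninConstant_modularDegree_holds` — Shimura's construction, Faltings'
  isogeny theorem, the uniformisation and the degree of `Y₀(N) → ℂ/Λ`, all theorems of the tree);
* **the Mazur–Kenku comparison is Mazur–Kenku plus the integrality of rational multipliers**:
  `PastenShimura2024_minimalDegree_le_163_mul_of_mazurKenku` (`PastenSpectralDegreeIsogenyBoundProofs`)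
  derives it from the named fact `mazurKenku_exists_cyclic_isogeny` (Mazur 1978, Thm. 1; Kenku 1982)
  and the hypothesis `hInt` (Edixhoven 1991, Prop. 2 / Stevens 1989, §1: a rational `q` with
  `q Λ_f ⊆ Λ_{E'}`, `Λ_{E'}` the Néron lattice of a globally minimal parametrised curve, is an
  integer — the Manin constant of an arbitrary parametrisation is integral);

and Deligne's fact is interderivable with Théorème (8.2) as printed
(`Deligne1974_heckeT_eigenvalue_norm_le_iff_newform_coeff_bound`), of which only the weight-`2` case
(Eichler 1954 – Shimura 1958 – Igusa 1959 via Weil's Riemann hypothesis for curves; Pasten p. 26: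
"the Hasse-Weil bound on the Fourier coefficients of a normalized eigenform of weight `2`") is used
(`Deligne1974_heckeT_eigenvalue_norm_le.weight_two_of_newform_coeff_bound`).

This file records the resulting assemblies (one-line compositions; nothing is restated):

* `pasten_thm_7_5_of_modularity_mazurKenku_deligne_murty` — Thm. 7.5 from the THREE remaining named
  facts of the tree (`nonempty_modularParametrizationData`, `PastenShimura2024_minimalDegree_le_163_mul`,
  `Deligne1974_heckeT_eigenvalue_norm_le`) and Murty's Lemma 11; so
  `pasten_thm_7_5_holds` is this theorem applied to their three `_holds` and a vendored-and-proved
  Lemma 11 in the shape `hMurty` below.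
* `pasten_thm_7_5_of_modularity_mazurKenku_murty_of_weight_two_bound` — the same with Deligne's fact
  replaced by the weight-`2` eigenvalue bound actually used.
* `pasten_thm_7_5_of_exists_isNewformOf` — the same as the first with the parametrisation datum taken
  from modularity "Version `a_p`" (`exists_isNewformOf`), the form in which the Modularity Theorem
  is a named fact of the tree.
* `pasten_thm_7_5_of_printed_inputs` — **Thm. 7.5 from exactly the external inputs of the printed
  proof** (§3 p. 13, §7.2 p. 26, §7.4 p. 27), each in the form the tree states it:
  (1) the Modularity Theorem "Version `a_p`" (`exists_isNewformOf`: Wiles, Taylor–Wiles,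
  Breuil–Conrad–Diamond–Taylor Thm. A; Diamond–Shurman Thm. 8.8.3);
  (2) Mazur–Kenku (`mazurKenku_exists_cyclic_isogeny`: "The degree of a minimal isogeny between
  `A_{1,N}` and `E` is uniformly bounded by `163`", p. 13);
  (3) the integrality of Manin constants (`hInt`, p. 13: "The Manin constant is a positive integer
  (cf. [Edixhoven])" together with "Lemma 5 in [Faltings]", `|h(A_{1,N}) − h(E)| ≤ ½ log 163` —
  in the tree's lattice idiom both are the integrality of the rational multiplier `q` of the
  parametrisation `X₀(N) → ℂ/Λ_f → ℂ/Λ_E` of a globally minimal `E`, Edixhoven 1991, Prop. 2, the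
  hypothesis of `PastenShimura2024_minimalDegree_le_163_mul_of_mazurKenku`);
  (4) the Hasse–Weil bound `|a_p(g)| ≤ 2√p` for normalised newforms of weight `2` (p. 26);
  (5) Murty's Lemma 11, "`n_c ≪_ε N^{1+ε}`" as used on p. 26 (`hMurty`: for newforms `f` of level
  `N` and `g` of level `M ∣ N` that differ at some index coprime to `N`, a distinguishing index
  `n ≤ C_ε N^{1+ε}` coprime to `N`).
  Everything else in the printed proof of Thm. 7.5 — and of the results of the paper it rests on
  (Thm. 5.5 = Thm. 1.8, Prop. 7.1, Thm. 7.2, (3.1), (3.2)) — is proved in the tree.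

The shape `hMurty` is the statement a cite item for [Murty1999CongruencePrimes, §6 Lemma 11]
should imply (Murty: `f` a newform of weight `2` and level `N`, `g` another newform; "there is an
`n = O(N^{1+ε} M^ε)` such that `(n, M) = 1` and `aₙ(f) ≠ aₙ(g)`", applied by Pasten with Murty's
auxiliary modulus `M := N`).

## References

* H. Pasten, *Shimura curves and the abc conjecture*, J. Number Theory 254 (2024), 214–335,
  doi:10.1016/j.jnt.2023.07.002 = arXiv:1705.09251: §3 (p. 13), Thm. 7.2 and its proof (p. 26),
  Thm. 7.5 and §7.4 (p. 27). [PastenShimura2024]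
* M. R. Murty, *Bounds for congruence primes*, in: Automorphic forms, automorphic representations,
  and arithmetic, Proc. Sympos. Pure Math. 66.1 (1999), 177–192: §6, Lemma 11.
  [Murty1999CongruencePrimes]
* B. Mazur, *Rational isogenies of prime degree*, Invent. Math. 44 (1978), 129–162: Thm. 1.
  [Mazur1978]
* M. A. Kenku, *On the number of `ℚ`-isomorphism classes of elliptic curves in each `ℚ`-isogeny
  class*, J. Number Theory 15 (1982), 199–202. [Kenku1982]
* B. Edixhoven, *On the Manin constants of modular elliptic curves*, in: Arithmetic algebraic
  geometry (Texel, 1989), Progr. Math. 89 (1991), 25–39: Prop. 2. [EdixhovenManin1991]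
* C. Breuil, B. Conrad, F. Diamond, R. Taylor, *On the modularity of elliptic curves over `ℚ`: wild
  3-adic exercises*, J. Amer. Math. Soc. 14 (2001), 843–939: Thm. A. [BCDTJAMS2001]
* P. Deligne, *La conjecture de Weil. I*, Publ. Math. IHÉS 43 (1974), 273–307: Thm. (8.2).
  [Deligne1974]
-/

noncomputable section

open scoped MatrixGroups ModularForm

open CongruenceSubgroup UpperHalfPlane

namespace Literature.NumberTheory.EllipticCurves

open ModularForms WeierstrassCurve

/-- **Pasten, Thm. 7.5 (`log |Δ_E| < (1/4 + ε) N log N` for `N ≫_ε 1`) from the three remaining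
named facts and Murty's Lemma 11.** As `pasten_thm_7_5_of_modularity_of_murtyLemma`, with its
hypothesis `h55` (Pasten's Thm. 5.5) discharged by the tree's theorem
`PastenShimura2024_thm_5_5_holds`. Remaining inputs: (i) the Modularity Theorem with integral Manin
constant (`nonempty_modularParametrizationData`), (ii) the Mazur–Kenku comparison
(`PastenShimura2024_minimalDegree_le_163_mul`), (iii) Deligne's bound
(`Deligne1974_heckeT_eigenvalue_norm_le`) — named facts of the tree — and (iv) Murty's Lemma 11
(`hMurty`, "`n_c ≪_ε N^{1+ε}`" as used on p. 26; not vendored).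
[cite: PastenShimura2024, Theorem 7.5 (proof, §7.4 p. 27) with Thm 7.2 (proof, p. 26) and Thm. 5.5]
[cite: Murty1999CongruencePrimes, §6 Lemma 11] -/
theorem pasten_thm_7_5_of_modularity_mazurKenku_deligne_murty
    (hmod : nonempty_modularParametrizationData)
    (h163 : PastenShimura2024_minimalDegree_le_163_mul)
    (hDel : Deligne1974_heckeT_eigenvalue_norm_le)
    (hMurty : ∀ ε : ℝ, 0 < ε → ∃ C : ℝ, ∀ (N M : ℕ) [NeZero N] [NeZero M], M ∣ N →
      ∀ (f : CuspForm (Gamma0 N) 2) (g : CuspForm (Gamma0 M) 2), IsNewform0 f → IsNewform0 g →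
        (∃ n : ℕ, n.Coprime N ∧ (qExpansion 1 ⇑f).coeff n ≠ (qExpansion 1 ⇑g).coeff n) →
          ∃ n : ℕ, n.Coprime N ∧ (n : ℝ) ≤ C * (N : ℝ) ^ (1 + ε) ∧
            (qExpansion 1 ⇑f).coeff n ≠ (qExpansion 1 ⇑g).coeff n) :
    pasten_thm_7_5 :=
  pasten_thm_7_5_of_modularity_of_murtyLemma hmod h163 PastenShimura2024_thm_5_5_holds hDel hMurty

/-- **Pasten, Thm. 7.5 from modularity, the Mazur–Kenku comparison, the weight-`2` eigenvalue bound
and Murty's Lemma 11.** As `pasten_thm_7_5_of_modularity_of_murtyLemma_of_weight_two_bound` with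
Thm. 5.5 discharged (`PastenShimura2024_thm_5_5_holds`): Deligne's fact is replaced by what the
proof uses, the bound `|μ| ≤ 2√p` for the eigenvalues of `T_p` (`p ∤ N`) on `S₂(Γ₀(N))`
(Eichler–Shimura–Igusa via Weil; Pasten p. 26, "the Hasse-Weil bound on the Fourier coefficients
of a normalized eigenform of weight `2`").
[cite: PastenShimura2024, Theorem 7.5 (proof, §7.4 p. 27) with Thm 7.2 (proof, p. 26)]
[cite: Murty1999CongruencePrimes, §6 Lemma 11] -/
theorem pasten_thm_7_5_of_modularity_mazurKenku_murty_of_weight_two_bound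
    (hmod : nonempty_modularParametrizationData)
    (h163 : PastenShimura2024_minimalDegree_le_163_mul)
    (h2 : ∀ (N : ℕ) [NeZero N] (p : ℕ) [NeZero p], p.Prime → ¬ p ∣ N → ∀ μ : ℂ,
      Module.End.HasEigenvalue (heckeT (Gamma0 N) 2 p) μ → ‖μ‖ ≤ 2 * Real.sqrt p)
    (hMurty : ∀ ε : ℝ, 0 < ε → ∃ C : ℝ, ∀ (N M : ℕ) [NeZero N] [NeZero M], M ∣ N →
      ∀ (f : CuspForm (Gamma0 N) 2) (g : CuspForm (Gamma0 M) 2), IsNewform0 f → IsNewform0 g →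
        (∃ n : ℕ, n.Coprime N ∧ (qExpansion 1 ⇑f).coeff n ≠ (qExpansion 1 ⇑g).coeff n) →
          ∃ n : ℕ, n.Coprime N ∧ (n : ℝ) ≤ C * (N : ℝ) ^ (1 + ε) ∧
            (qExpansion 1 ⇑f).coeff n ≠ (qExpansion 1 ⇑g).coeff n) :
    pasten_thm_7_5 :=
  pasten_thm_7_5_of_modularity_of_murtyLemma_of_weight_two_bound hmod h163
    PastenShimura2024_thm_5_5_holds h2 hMurty

/-- **Pasten, Thm. 7.5 from the Modularity Theorem "Version `a_p`", the two other remaining named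
facts and Murty's Lemma 11.** As `pasten_thm_7_5_of_modularity_mazurKenku_deligne_murty`, with the
parametrisation datum (`nonempty_modularParametrizationData`: modularity with a non-zero integral
Manin constant, BCDT Thm. A in the form (6)) obtained from modularity in the form (2),
`exists_isNewformOf` (a newform `f ∈ S₂(Γ₀(N_E))` with `aₙ(f) = aₙ(E)`), through the tree's
`nonempty_modularParametrizationData_of_modularity` and the discharged leaf
`IsNewformOf.exists_maninConstant_modularDegree_holds` (Shimura's construction, Faltings' isogeny
theorem, uniformisation, degree of `Y₀(N) → ℂ/Λ`).
[cite: PastenShimura2024, Theorem 7.5 (proof, §7.4 p. 27) with §3 p. 13 and Thm 7.2 (proof, p. 26)]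
[cite: BCDTJAMS2001, Thm. A] [cite: Murty1999CongruencePrimes, §6 Lemma 11] -/
theorem pasten_thm_7_5_of_exists_isNewformOf
    (h₁ : exists_isNewformOf)
    (h163 : PastenShimura2024_minimalDegree_le_163_mul)
    (hDel : Deligne1974_heckeT_eigenvalue_norm_le)
    (hMurty : ∀ ε : ℝ, 0 < ε → ∃ C : ℝ, ∀ (N M : ℕ) [NeZero N] [NeZero M], M ∣ N →
      ∀ (f : CuspForm (Gamma0 N) 2) (g : CuspForm (Gamma0 M) 2), IsNewform0 f → IsNewform0 g →
        (∃ n : ℕ, n.Coprime N ∧ (qExpansion 1 ⇑f).coeff n ≠ (qExpansion 1 ⇑g).coeff n) →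
          ∃ n : ℕ, n.Coprime N ∧ (n : ℝ) ≤ C * (N : ℝ) ^ (1 + ε) ∧
            (qExpansion 1 ⇑f).coeff n ≠ (qExpansion 1 ⇑g).coeff n) :
    pasten_thm_7_5 :=
  pasten_thm_7_5_of_modularity_mazurKenku_deligne_murty
    (nonempty_modularParametrizationData_of_modularity h₁
      IsNewformOf.exists_maninConstant_modularDegree_holds) h163 hDel hMurty

/-- **Pasten, Thm. 7.5 (`log |Δ_E| < (1/4 + ε) N log N` for every elliptic curve `E/ℚ` of conductor
`N ≫_ε 1`) from exactly the external inputs of the printed proof**, each as the tree states it: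
(1) `h₁` — the Modularity Theorem "Version `a_p`", `exists_isNewformOf` (Wiles 1995, Taylor–Wiles
1995, Breuil–Conrad–Diamond–Taylor 2001 Thm. A; level `N_E` by Carayol), which gives the
parametrisation datum through `nonempty_modularParametrizationData_of_modularity` and the
discharged leaf `IsNewformOf.exists_maninConstant_modularDegree_holds`;
(2) `hMK` — Mazur–Kenku, `mazurKenku_exists_cyclic_isogeny` (p. 13: "The degree of a minimal
isogeny between `A_{1,N}` and `E` is uniformly bounded by `163`");
(3) `hInt` — the integrality of the Manin constant of a parametrisation of a globally minimal
curve (p. 13: "The Manin constant is a positive integer (cf. [Edixhoven])" and "Lemma 5 in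
[Faltings] gives `|h(A_{1,N}) − h(E)| ≤ ½ log 163`"; Edixhoven 1991, Prop. 2), in the lattice form
consumed by `PastenShimura2024_minimalDegree_le_163_mul_of_mazurKenku` (a rational `q` with
`q Λ_f ⊆ Λ_{E'}` is an integer);
(4) `h2` — the Hasse–Weil bound `|a_p(g)| ≤ 2√p` (`p ∤ M`) for normalised newforms `g` of weight
`2` and level `M` (p. 26), transported to all eigenvalues of `T_p` on `S₂(Γ₀(N))` by the tree's
Atkin–Lehner theory (`Deligne1974_heckeT_eigenvalue_norm_le.weight_two_of_newform_coeff_bound`);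
(5) `hMurty` — Murty's Lemma 11, "`n_c ≪_ε N^{1+ε}`" (p. 26).
Pasten's own results used on the way — (3.1), (3.2), Thm. 5.5, Prop. 7.1, Thm. 7.2 (asymptotic
clause) and §7.4 — are theorems of the tree (`PastenShimura2024_thm_5_5_holds`,
`exists_sum_finrank_quotient_minimalPrimes_two_le`, `Pasten2024.log_modularDegree_lt_of_thm_5_5_asymptotic'`,
`pasten_thm_7_5_of_modularity`, …), so this theorem displays the complete trust base of
`pasten_thm_7_5` over the tree.
[cite: PastenShimura2024, Theorem 7.5 (proof, §7.4 p. 27) with §3 p. 13 and Thm 7.2 (proof, p. 26)]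
[cite: Murty1999CongruencePrimes, §6 Lemma 11] [cite: Mazur1978, Thm. 1] [cite: Kenku1982]
[cite: EdixhovenManin1991, Prop. 2] [cite: BCDTJAMS2001, Thm. A] -/
theorem pasten_thm_7_5_of_printed_inputs
    (h₁ : exists_isNewformOf)
    (hMK : mazurKenku_exists_cyclic_isogeny)
    (hInt : ∀ {N : ℕ} [NeZero N] {W' : WeierstrassCurve ℚ} [W'.IsElliptic] [W'.IsGloballyMinimal]
      (D' : ModularParametrizationData W' N) (q : ℚ),
      (∀ z ∈ periodLattice D'.f, (q : ℂ) * z ∈ D'.L.lattice) → ∃ k : ℤ, (k : ℚ) = q)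
    (h2 : ∀ (M : ℕ) [NeZero M] (g : CuspForm (Gamma0 M) 2), IsNewform0 g →
      ∀ p : ℕ, p.Prime → ¬ p ∣ M → ‖(qExpansion 1 ⇑g).coeff p‖ ≤ 2 * Real.sqrt p)
    (hMurty : ∀ ε : ℝ, 0 < ε → ∃ C : ℝ, ∀ (N M : ℕ) [NeZero N] [NeZero M], M ∣ N →
      ∀ (f : CuspForm (Gamma0 N) 2) (g : CuspForm (Gamma0 M) 2), IsNewform0 f → IsNewform0 g →
        (∃ n : ℕ, n.Coprime N ∧ (qExpansion 1 ⇑f).coeff n ≠ (qExpansion 1 ⇑g).coeff n) →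
          ∃ n : ℕ, n.Coprime N ∧ (n : ℝ) ≤ C * (N : ℝ) ^ (1 + ε) ∧
            (qExpansion 1 ⇑f).coeff n ≠ (qExpansion 1 ⇑g).coeff n) :
    pasten_thm_7_5 :=
  pasten_thm_7_5_of_modularity_mazurKenku_murty_of_weight_two_bound
    (nonempty_modularParametrizationData_of_modularity h₁
      IsNewformOf.exists_maninConstant_modularDegree_holds)
    (PastenShimura2024_minimalDegree_le_163_mul_of_mazurKenku hMK hInt)
    (Deligne1974_heckeT_eigenvalue_norm_le.weight_two_of_newform_coeff_bound h2) hMurty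

end Literature.NumberTheory.EllipticCurves

end
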